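import Summits.BirchSwinnertonDyer.BirchSwinnertonDyer.Theses.SignedLowerHalves
import Summits.BirchSwinnertonDyer.BirchSwinnertonDyer.Theorems.PrintX8SharpFlatRankZeroRoad
import Literature.NumberTheory.EllipticCurves.BurungaleKobayashiOta2024.RankOnePPartOfSharpFlatMainConjecture
import HarnessLib

/-!
# Route `SignedLowerHalves`, crux 6 `SharpFlatResiduePPart` (item stmt-BirchSwinnertonDyer-19004)
# REDUCED to Sprung's ♯/♭ Main Conjecture 7.21 on corner X8 — both reasons for declaring it residual
# ("rank 1 needs a ♯/♭ Cor. A.5, not vendored; rank 0 small image has no published upper half")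
# discharged BY NAME (cell `bsd-print-x8`, seat p1 «Sprung 2024 BY NAME: acquire, type, discharge»;
# `--supports stmt-BirchSwinnertonDyer-19004`)

PARTITION (D-0054(2)): corner X8 = K3 row A8 — the cells off the branch `r_an = 0 ∧ Surj(3)` that
route `SignedLowerHalves` (cell `bsd-ssimc`) declared residual: rank `1` (75 census rows) and rank-`0`
image `3Nn` (60 rows); proves «Main Conj. 7.21 on X8 ⟹ `SharpFlatResiduePPart`» modulo PUBLISHED
named facts; closes NONE (the main conjecture at `a_3 = ±3` is OPEN in print); 0 census cells move;
BSD is not proved by any of this. Beyond-print theorem: NO (rank `1` = the ♯/♭ reading of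
Burungale–Kobayashi–Ota Cor. A.5, cell seat ty1 p532534, with its admissible colour discharged by
Sprung 2017 Thm. 1.12 / Sprung 2012 Prop. 6.14, tree theorems; rank `0` = Sprung 2024 §5.2 in the
kernel WITHOUT Kato's divisibility, file `PrintX8SharpFlatRankZeroRoad.lean`).

READING for the tenure planner of `SignedLowerHalves`: after this file, crux 6's genuinely open content
is ONE named Λ-adic object per pair — `Theorems.SprungSharpFlatMainConjecture W 3 •` — the same object
as crux 5's child K1 (item 19875, its Eisenstein half) completed by Kato's half; on the 61 image-`3Nn`
cells Kato's half is integral only conjecturally (Sprung 2012 Thm. 7.16, `n ≥ 0`), which is why the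
EQUALITY and not the lower divisibility is the right residual there. Sister route `PrintX8` (cell
`bsd-print-x8`) files exactly this object as its crux C1 `SharpFlatMainConjectureX8`.

HONEST STATUS: CONDITIONAL on the displayed named facts (all PUBLISHED; ty1's Cor. A.5 reading carries
the PUB* locator flag `BKO24-CorA5-sharpflat-via-Spr12-7.19`) and on the OPEN main conjecture taken
as hypothesis; closes nothing.

References: [BurungaleKobayashiOta2023] App. A Cor. A.5; [Sprung2012] Prop. 6.14, Thm. 7.14, Thm. 7.16,
Prop. 7.19, Main Conj. 7.21; [Sprung2017] Thm. 1.12; [Sprung2024] Thm. 5.2, Thm. 5.3, §5.2;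
[Miller2011LMS] Def. 1.1.
-/

set_option autoImplicit false
-- justification: the mandated namespace `Summit.BirchSwinnertonDyer.BirchSwinnertonDyer.Theorems`
-- (single-conjunct summit, Sub = Summit) repeats a segment by design (D-0017).
set_option linter.dupNamespace false

noncomputable section

namespace Summit.BirchSwinnertonDyer.BirchSwinnertonDyer.Theorems.X8MainConjectureRoad

open scoped Classical NumberField MatrixGroups ModularForm
open NumberField IsDedekindDomain WeierstrassCurve CongruenceSubgroup
  Literature.NumberTheory.EllipticCurves Literature.NumberTheory.EllipticCurves.ModularForms
  Literature.NumberTheory.EllipticCurves.Rank1Residual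
  Literature.NumberTheory.EllipticCurves.Rank1Residual.Typed
  Literature.NumberTheory.EllipticCurves.Sprung2017 Literature.NumberTheory.EllipticCurves.Sprung2012
  Literature.NumberTheory.EllipticCurves.Sprung2024
  Literature.NumberTheory.EllipticCurves.BurungaleKobayashiOta2024
  Literature.NumberTheory.EllipticCurves.ZpExtension
  Summit.BirchSwinnertonDyer.Rank1Residual.Supersingular
  Summit.BirchSwinnertonDyer.BirchSwinnertonDyer.Theses.SignedLowerHalves

/-- **X8 ∧ `r_an = 1`, ANY image / conductor: Main Conj. 7.21 at `(E, 3)` for both colours ⟹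
`MissingPPartAt W 3`**, granted BY NAME ty1's ♯/♭ reading of Burungale–Kobayashi–Ota Cor. A.5 (`hA5`),
BCDT modularity (`hmodf`), GZK, `hasEntireLFunction_rat` — the admissible colour (newform, Sprung pair
by `thm112_exists_isSprungPair_holds`, `L^• ≠ 0` by `IsSprungPair.exists_chromaticL_ne_zero`) being
discharged here. Conditional; closes nothing. [cite: BurungaleKobayashiOta2023, App. A Cor. A.5]
[cite: Sprung2012, Prop. 6.14 (p. 1498), Prop. 7.19 and Main Conj. 7.21 (p. 1505)] [cite: Sprung2017, Thm. 1.12]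
[cite: Miller2011LMS, §1 and Def. 1.1] -/
theorem X8.missingPPartAt_of_sprungSharpFlatMainConjecture_of_corA5_of_analyticRank_eq_one
    (hA5 : corA5_pPart_of_sharpFlatCharIdeal_eq) (hmodf : exists_isNewformOf)
    (hGZK : rank_eq_analyticRank_of_analyticRank_le_one) (hmod : hasEntireLFunction_rat)
    (W : WeierstrassCurve ℚ) [W.IsElliptic] [W.IsGloballyMinimal] (p : ℕ) [Fact p.Prime]
    (hX : ClassX8 W p) (h1 : W.analyticRank = 1)
    (hMC : ∀ col : Chroma, SprungSharpFlatMainConjecture W p col) : MissingPPartAt W p := by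
  have hp3 : p = 3 := hX.1
  subst hp3
  have hgood : W.HasGoodReductionAtPrime 3 := hX.2.1.1
  have hdvd : ((3 : ℕ) : ℤ) ∣ W.frobeniusTrace 3 := hX.2.1.2
  haveI : NeZero (W.conductorNorm ℤ) := ⟨(W.conductorNorm_pos_holds).ne'⟩
  obtain ⟨f, hf⟩ := hmodf W
  obtain ⟨Lsharp, Lflat, hSP⟩ :=
    thm112_exists_isSprungPair_holds (W := W) (f := f) (p := 3) (by decide) hf hgood hdvd
  obtain ⟨col, hcol⟩ := hSP.exists_chromaticL_ne_zero hf hgood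
  exact missingPPartAt_of_corA5_sharpFlat W 3 hA5 hmod hGZK col (by decide) hgood hdvd h1 f
    (not_dvd_level_of_isNewformOf hf hgood) Lsharp Lflat hf hSP hcol (hMC col)

/-- **Route `SignedLowerHalves`, crux 6 `SharpFlatResiduePPart`, REDUCED to Sprung's ♯/♭ main
conjecture on corner X8.** Modulo the displayed PUBLISHED facts (ty1's ♯/♭ Cor. A.5 reading `hA5`,
BCDT `hmodf`, Sprung 2012 Thm. 2.2 `h22` / Thm. 7.14 `h714`, Sprung 2024 Lemmas 5.5–5.9 at all levels
`h59`, the period unit at `3` `h3`, GZK, modularity): «for every X8 pair of analytic rank `≤ 1` and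
every colour `•`, `Theorems.SprungSharpFlatMainConjecture W p •`» ⟹ `SharpFlatResiduePPart` — its
proviso `¬(r_an = 0 ∧ Surj(3))` is not even used (the rank-`0` road of `PrintX8SharpFlatRankZeroRoad`
is image-free). What remains of crux 6 is the ONE named object, OPEN in print at `a_3 = ±3`.
Conditional; closes nothing. [cite: Sprung2024, Thm. 5.2, Thm. 5.3 (p. 38) and §5.2 (pp. 39–41)]
[cite: BurungaleKobayashiOta2023, App. A Cor. A.5] [cite: Sprung2012, Prop. 7.19 and Main Conj. 7.21 (p. 1505)] -/
theorem sharpFlatResiduePPart_of_mainConjecture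
    (hA5 : corA5_pPart_of_sharpFlatCharIdeal_eq)
    (hmodf : exists_isNewformOf) (h22 : thm22_exists_isHondaSystem)
    (h714 : thm714_sharpFlatSelmerDual_finite_torsion)
    (h59 : lem59AllN_sharpFlatCharValue_rankZero)
    (h3 : realPeriodRat_eq_unit_mul_plusPeriod_three)
    (hGZK : rank_eq_analyticRank_of_analyticRank_le_one) (hmod : hasEntireLFunction_rat)
    (hMC : ∀ (W : WeierstrassCurve ℚ) [W.IsElliptic] [W.IsGloballyMinimal] (p : ℕ) [Fact p.Prime],
      ClassX8 W p → W.analyticRank ≤ 1 → ∀ col : Chroma, SprungSharpFlatMainConjecture W p col) :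
    SharpFlatResiduePPart := by
  intro W _ _ p _ hX hr _
  rcases Nat.le_one_iff_eq_zero_or_eq_one.mp hr with h0 | h1
  · exact X8.missingPPartAt_of_sprungSharpFlatMainConjecture_of_analyticRank_eq_zero hmodf h22 h714 h59
      h3 hGZK hmod W p hX h0 (hMC W p hX hr)
  · exact X8.missingPPartAt_of_sprungSharpFlatMainConjecture_of_corA5_of_analyticRank_eq_one hA5 hmodf
      hGZK hmod W p hX h1 (hMC W p hX hr)

end Summit.BirchSwinnertonDyer.BirchSwinnertonDyer.Theorems.X8MainConjectureRoad

end
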